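/-
Copyright (c) 2026 the pub-hodgecm-mathlib formalisation cell (harness21).  Prover seat hodgecm-mathlib-K2Liu-p05 (g0): Track B «K2-LIT»,
#184♮ = hLiu418 = stmt-HodgeConjecture-24832; socket #32d `sig_K2LiuDoublingHeightDecayLocal` of `Cruxes/HLiu418/Lines/K2_Liu_CurveThetaSigs_U5d_ZetaS.lean`
(ED. 1 a836627a4002dcd3 :224) — the analytic tail of the split finite slice organ; K2/STATUS 2026-09-04 (K2Liu-p05 (g0)).
-/
import Mathlib.Analysis.SpecificLimits.Normed
import Mathlib.Analysis.SpecialFunctions.Pow.Real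
import Mathlib.Topology.Algebra.InfiniteSum.NatInt
import Mathlib.Analysis.Normed.Ring.InfiniteSum
import Mathlib.Data.Fin.Tuple.Basic
import HarnessLib

/-!
# Crux `HLiu418`, road `K2_Liu`, unit U5d, socket #32d — the CARTAN LATTICE SUM `∑_{a ∈ ℤ^n} ∏_i (|a_i| + 1)^k s^{|a_i|} < ∞` (`0 ≤ s < 1`)

Cell `hodgecm-mathlib`, crux item hLiu418 = `stmt-HodgeConjecture-24832`; squad K2 ∕ K2Liu, LEAD F0P6-plan (g10), planner K2Liu-plan (g2), prover
K2Liu-p05 (g0).  THEOREMS ONLY (no `def` ∕ instance ∕ notation ∕ named-fact hypothesis ∕ `sorry`, default heartbeats); lane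
`--supports stmt-HodgeConjecture-24832 --as helper` (count-neutral).  PURE real analysis (Mathlib only).

WHY.  After ★ `integrable_of_cartanSeries` the split `v`-slice of #32d is integrable iff its Cartan series `∑_{a} ν(K t_a K)·ψ_v(t_a)^τ` over the
lattice `a ∈ ℤ^N` (antitone representatives) converges.  The two arithmetic inputs — `ψ_v(t_a) ≍ q_v^{−Σ|a_i|∕2}` (★ `exists_twoSided_modDelta_of_localDecomp` +
★ `K2LiuSplitCartanIwasawa`) and the volume count `#(K t_a K∕K) ≤ (|a⁺|+1)^N (|a⁻|+1)^N q_v^{(N−1)(Σ|a_i|)}` (★ `card_cosets_glIntDet_le_pow_mul`, Macdonald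
V (4.6), through the sign split `t_a = t_{a⁺}·t_{a⁻}`) — dominate the series termwise by `∏_i (|a_i|+1)^{2N} s^{|a_i|}` with
`s = q_v^{(N−1) − τ∕2} < 1` EXACTLY WHEN `τ > 2N − 2` — the sharp abscissa of the socket.  This file proves that the dominating lattice sum converges
([Macdonald1995, Ch. V (2.9), (4.6)]; [GelbartPiatetskishapiroRallis1987, Part A §6]; [Li1992, §3 Thm. 3.1]):

* §1 `summable_abs_succ_pow_mul_geometric_int` — `∑_{m ∈ ℤ} (|m|+1)^k s^{|m|} < ∞` (binomial expansion onto Mathlib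
  `summable_pow_mul_geometric_of_norm_lt_one` on each half-line, glued by Mathlib `Summable.of_nat_of_neg`).
* §2 **`summable_pi_prod`** — a product of non-negative summable one-variable weights is summable over `Fin n → ℤ` (induction on `n` along
  Mathlib `Fin.consEquiv`, `Summable.mul_of_nonneg`); **`summable_cartanLattice`** — `∑_{a : Fin n → ℤ} ∏_i (|a_i|+1)^k s^{|a_i|} < ∞` for `0 ≤ s < 1`.

HONEST LABEL.  Count-neutral helper (analytic tail of the split slice organ of #32d; the volume count and the evaluation are the ★ inputs named above,
their assembly is the remaining organ): `HC_CM` is proved only modulo the 7 printed citations (2 remaining named inputs: hLiu418 =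
`stmt-HodgeConjecture-24832`, h413 = `stmt-HodgeConjecture-24833`) until rung 0 closes.
References: [Macdonald1995] *Symmetric functions and Hall polynomials*, Ch. V (2.9), (4.6); [GelbartPiatetskishapiroRallis1987] LNM 1254, Part A §6;
[Li1992] J. reine angew. Math. 428, §3 Thm. 3.1.
-/

set_option autoImplicit false
-- the mandated namespace repeats the single-problem summit's segment (`HodgeConjecture.HodgeConjecture`)
set_option linter.dupNamespace false

noncomputable section

open Finset

namespace Summit.HodgeConjecture.HodgeConjecture.Cruxes.HLiu418.K2LiuCartanLatticeSummable

/-! ## §1 One variable: `∑_m (m+1)^k s^m` and its two-sided version -/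

/-- `∑_{m ∈ ℤ} (|m|+1)^k s^{|m|} < ∞` for `0 ≤ s < 1`: on each half-line this is `∑_{m ∈ ℕ} (m+1)^k s^m`, summable by the binomial
expansion of `(m+1)^k` onto Mathlib `summable_pow_mul_geometric_of_norm_lt_one` (the `ℕ`-statement is ★
`Literature.Probability.Percolation.summable_succ_pow_mul_geometric`, re-derived inline here to keep this file's imports inside Mathlib); the two
half-lines are glued by Mathlib `Summable.of_nat_of_neg`. [cite: Macdonald1995, Ch. V (2.9)] -/
theorem summable_abs_succ_pow_mul_geometric_int (k : ℕ) {s : ℝ} (hs0 : 0 ≤ s) (hs1 : s < 1) :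
    Summable fun m : ℤ => ((|m| : ℝ) + 1) ^ k * s ^ m.natAbs := by
  have hs : ‖s‖ < 1 := by rwa [Real.norm_of_nonneg hs0]
  have h : Summable fun m : ℕ => ((m : ℝ) + 1) ^ k * s ^ m := by
    have h' : Summable fun m : ℕ => ∑ j ∈ range (k + 1), (k.choose j : ℝ) * ((m : ℝ) ^ j * s ^ m) :=
      summable_sum fun j _ => (summable_pow_mul_geometric_of_norm_lt_one j hs).mul_left _
    refine h'.congr fun m => ?_
    rw [add_pow, Finset.sum_mul]
    refine Finset.sum_congr rfl fun j _ => ?_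
    rw [one_pow, mul_one]
    ring
  refine Summable.of_nat_of_neg ?_ ?_
  · refine h.congr fun m => ?_
    simp only [Int.cast_natCast, Nat.abs_cast, Int.natAbs_natCast]
  · refine h.congr fun m => ?_
    simp only [Int.cast_neg, Int.cast_natCast, abs_neg, Nat.abs_cast, Int.natAbs_neg, Int.natAbs_natCast]

/-- the one-variable weight is non-negative. [cite: Macdonald1995, Ch. V (2.9)] -/
theorem abs_succ_pow_mul_geometric_nonneg (k : ℕ) {s : ℝ} (hs0 : 0 ≤ s) (m : ℤ) :
    0 ≤ ((|m| : ℝ) + 1) ^ k * s ^ m.natAbs :=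
  mul_nonneg (pow_nonneg (by positivity) _) (pow_nonneg hs0 _)

/-! ## §2 The lattice `Fin n → ℤ`: products of one-variable weights -/

/-- induction step, product form: `∑_{(m, a) ∈ ℤ × ℤ^n} g(m) ∏_i g(a_i) < ∞` from the two factors (Mathlib `Summable.mul_of_nonneg`).
[cite: Macdonald1995, Ch. V (2.9)] -/
theorem summable_mul_prod_step (n : ℕ) {g : ℤ → ℝ} (hg0 : ∀ m, 0 ≤ g m) (hg : Summable g)
    (ih : Summable fun a : Fin n → ℤ => ∏ i, g (a i)) :
    Summable fun x : ℤ × (Fin n → ℤ) => g x.1 * ∏ i, g (x.2 i) := by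
  have h0f : (0 : ℤ → ℝ) ≤ g := fun m => hg0 m
  have h0P : (0 : (Fin n → ℤ) → ℝ) ≤ fun a => ∏ i, g (a i) := fun a => Finset.prod_nonneg fun i _ => hg0 (a i)
  exact Summable.mul_of_nonneg (f := g) (g := fun a : Fin n → ℤ => ∏ i, g (a i)) hg ih h0f h0P

/-- induction step, lattice form: transport along `Fin.consEquiv : ℤ × ℤ^n ≃ ℤ^{n+1}` (`∏_{i ≤ n} = g(a_0) · ∏_{i < n}`, Mathlib `Fin.prod_univ_succ`).
[cite: Macdonald1995, Ch. V (2.9)] -/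
theorem summable_pi_succ_of_prod (n : ℕ) {g : ℤ → ℝ}
    (hprod : Summable fun x : ℤ × (Fin n → ℤ) => g x.1 * ∏ i, g (x.2 i)) :
    Summable fun a : Fin (n + 1) → ℤ => ∏ i, g (a i) := by
  refine (Equiv.summable_iff (Fin.consEquiv fun _ => ℤ)).1 (hprod.congr fun x => ?_)
  show g x.1 * ∏ i, g (x.2 i) = ∏ i : Fin (n + 1), g ((Fin.cons x.1 x.2 : Fin (n + 1) → ℤ) i)
  rw [Fin.prod_univ_succ, Fin.cons_zero]
  simp only [Fin.cons_succ]

/-- **a product of non-negative summable one-variable weights is summable over the lattice `Fin n → ℤ`** (induction on `n`).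
[cite: Macdonald1995, Ch. V (2.9)] -/
theorem summable_pi_prod {g : ℤ → ℝ} (hg0 : ∀ m, 0 ≤ g m) (hg : Summable g) (n : ℕ) :
    Summable fun a : Fin n → ℤ => ∏ i, g (a i) := by
  induction n with
  | zero => exact (hasSum_fintype fun a : Fin 0 → ℤ => ∏ i, g (a i)).summable
  | succ n ih => exact summable_pi_succ_of_prod n (summable_mul_prod_step n hg0 hg ih)

/-- **THE CARTAN LATTICE SUM CONVERGES**: `∑_{a : Fin n → ℤ} ∏_i (|a_i|+1)^k s^{|a_i|} < ∞` for `0 ≤ s < 1` — the dominating series of the Cartan series of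
the split `v`-slice of #32d at `s = q_v^{(N−1) − τ∕2}`, i.e. convergent iff `τ > 2N − 2`. [cite: Macdonald1995, Ch. V (2.9), (4.6)]
[cite: GelbartPiatetskishapiroRallis1987, Part A §6] [cite: Li1992, §3 Thm. 3.1] -/
theorem summable_cartanLattice (n k : ℕ) {s : ℝ} (hs0 : 0 ≤ s) (hs1 : s < 1) :
    Summable fun a : Fin n → ℤ => ∏ i, ((|a i| : ℝ) + 1) ^ k * s ^ (a i).natAbs :=
  summable_pi_prod (abs_succ_pow_mul_geometric_nonneg k hs0) (summable_abs_succ_pow_mul_geometric_int k hs0 hs1) n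

/-- the base `s = q^{(N−1) − τ∕2}` of the dominating series is `< 1` exactly on the socket's half-line `τ > 2N − 2` (`q > 1`).
[cite: GelbartPiatetskishapiroRallis1987, Part A §6] -/
theorem rpow_lt_one_of_sharp {q τ : ℝ} {N : ℕ} (hq : 1 < q) (hτ : 2 * (N : ℝ) - 2 < τ) :
    q ^ (((N : ℝ) - 1) - τ / 2) < 1 :=
  Real.rpow_lt_one_of_one_lt_of_neg hq (by linarith)

/-- … and it is non-negative. [cite: GelbartPiatetskishapiroRallis1987, Part A §6] -/
theorem rpow_sharp_nonneg {q τ : ℝ} {N : ℕ} (hq : 1 < q) : 0 ≤ q ^ (((N : ℝ) - 1) - τ / 2) :=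
  Real.rpow_nonneg (zero_le_one.trans hq.le) _

end Summit.HodgeConjecture.HodgeConjecture.Cruxes.HLiu418.K2LiuCartanLatticeSummable

end
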